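/-
Copyright (c) 2026 the pub-hodgecm-mathlib formalisation cell (harness21).  R90-TF SLAB, section S10 (Rogawski 1990, §13.8 Prop. 13.8.3 read at `v`),
prover R90-C138-p03 (g2) — DEAL #19-c (dealer R90-C138-plan (g3)): the (M-a) payer road (R4) at a SPLIT place, MODULO S4's (HC-LI) socket BY NAME;
h413 = `stmt-HodgeConjecture-24833`, route `HCCMUnconditional`.
-/
import Summits.HodgeConjecture.HodgeConjecture.Theorems.R90S10FrozenDatumDefs        -- ★ C2: `MatchE1`, carriers `HLoc`∕`Gqs`∕`Pl`, ★ `finExplicitCollection`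
import Summits.HodgeConjecture.HodgeConjecture.Theorems.R90S4HOrbDetWeylSplit       -- ★ (ORB-DET, every place): `R90.S4.integral_mul_eq_of_classOrbitalIntegral_eq_of_isLocSmooth`
import Summits.HodgeConjecture.HodgeConjecture.Theorems.R90S4StableClassSimilPair    -- ★ `R90.S4.setOf_isLocalStablyConjH_out_eq_singleton_of_split`
import Literature.NumberTheory.Automorphic.CMPrincipalSeriesHAdmissible                 -- ★ `cmPrincipalSeriesH`, `isAdmissible_cmPrincipalSeriesH`
import Literature.NumberTheory.Automorphic.ParabolicInductionAdmissibleProofs          -- ★ `Representation.IsAdmissible.of_equiv`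
import HarnessLib

/-!
# R90-TF ∕ S10 — (M-a) at a SPLIT place, road (R4): two `Δ‴_w`-partners of one `φ` have the same trace on every IRREDUCIBLE admissible `ρ_w`,
# modulo Harish-Chandra regularity on `H_w` (S4's socket (HC-LI), taken BY NAME)
# (`Theorems/R90S10SplitHTraceOfMatchedPair.lean`; ns `Summit.HodgeConjecture.HodgeConjecture.R90.S10`; lane `--supports stmt-HodgeConjecture-24833`)

Cell `hodgecm-mathlib`, crux H413 (`stmt-HodgeConjecture-24833`), route of record `HCCMUnconditional`; programme R90-TF, section S10 (base `R90-C138`).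
PROOF lane: theorems only (no `def`, no instance, no notation, no named fact, no `sorry`); ★-only imports (law L9: no `Cruxes/H413/Lines/*`).

THE CARD.  p06 (g0)'s letter (M-a) ★-cand `SplitHVanDijkLetter L μ w νHw mHw mQw` (`R90S10PSSplitInputLettersDefs` :70) — «at a split place, for canonical `mHw`,
the character of (a realisation `ρ_w` of) `i_H(χ₂ ⊠ χ₁)` takes the same value on any two test functions `f^H, f′^H` that are `Δ‴_w`-transfers of the SAME `φ`»
— the input that lets an ARBITRARY matched pair replace the named split transfer in letter (3) `PSLocalCharTransferLetter` [Rogawski1990 §4.9 L. 4.9.2, §13.8 p. 217].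
The tree's H-side van Dijk formula in ORBITAL form is ★ only at NON-split places (★ `smoothTrace_cmPrincipalSeriesH_eq_inv_mul_integral`, `hw : c • w = w`); this file
takes the OTHER road, which the tree already holds at EVERY place:
* ★ (ORB-DET) `R90.S4.integral_mul_eq_of_classOrbitalIntegral_eq_of_isLocSmooth` (`Theorems/R90S4HOrbDetWeylSplit` :214, R90-C131-p04): on `H_w = U(Φ₂)_w × U(Φ₁)_w`, two
  test functions with equal `G`-regular CANONICAL class orbital integrals have the same integral against every conjugation-invariant locally integrable measurable
  density [HarishChandra1970 Lemma 42; Rogawski1990 §12.5 p. 182];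
* ★ `R90.S4.setOf_isLocalStablyConjH_out_eq_singleton_of_split` (`Theorems/R90S4StableClassSimilPair` :138): at a SPLIT place the stable class of every `a ∈ H_w` is
  `{⟦a⟧}` (`H_w ≅ GL₂ × GL₁`, [Rogawski1990 §3.1 p. 19, §14.2 p. 232]) — so the `Δ‴_w`-transfer identity (4.3.1) `Φ^{st}(γ_H, f^H) = Σ_γ Δ‴_w(γ_H, γ) Φ(γ, φ)`
  (★ `IsLocalDeltaTransfer`, inside ★ C2 `MatchE1`) pins the CLASS orbital integrals of `f^H` at every `G`-regular `γ_H`;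
* Harish-Chandra's regularity theorem on `H_w` — the character of an irreducible admissible class `σ` is a conjugation-invariant locally integrable measurable FUNCTION
  `Θ_σ` with `Tr σ(f) = ∫ f Θ_σ` [HarishChandra1999 Thm. 16.3; Rogawski1990 §1.6 pp. 5–6] — is S4's OPEN socket (HC-LI) `stub_R90_S4_H_charLocIntHC`
  (`Cruxes/H413/Lines/R90_S4_HPacketsU2B.lean` :573); it is taken here as the HYPOTHESIS `hHCLI` whose TYPE is that socket's statement TOKEN FOR TOKEN, so a Lines
  edition pays it BY NAME (`… stub_R90_S4_H_charLocIntHC …`), never a `sorry`, never an axiom.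
Then `Tr ρ_w(f^H) = Tr ⟦ρ_w⟧(f^H) = ∫ f^H Θ = ∫ f′^H Θ = Tr ρ_w(f′^H)` for every IRREDUCIBLE admissible smooth `ρ_w` of `H_w` — in particular for the irreducible local
factors `ρ_w = 𝔥.ρ w` of the `H`-datum (★ C2 `S10HDatum.hirr`∕`hsm`∕`hadm`), principal series or not.
* §1 `stableOrbitalIntegralRel_eq_classOrbitalIntegral_of_split`, `classOrbitalIntegral_eq_of_isLocalDeltaTransfer_of_split` — ★ only, no hypothesis.
* §2 **`smoothTrace_eq_of_matchE1_of_split_of_irreducible`** — the (M-a) conclusion for irreducible admissible `ρ_w`, modulo `hHCLI`.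
* §3 **`splitHVanDijk_of_irreducible`** — (M-a)′: the BODY of p06's `SplitHVanDijkLetter L μ w νHw mHw mQw` with ONE binder `ρw.IsIrreducible →` inserted after
  `Nonempty (ρw.Equiv (cmPrincipalSeriesH L w χ₂ χ₁)) →` (everything else byte-identical), modulo `hHCLI`: admissibility∕smoothness of `ρ_w` come from the principal
  series (★ `isAdmissible_cmPrincipalSeriesH`) along the equivalence (★ `Representation.IsAdmissible.of_equiv`).
RESIDUAL vs (M-a) AS TYPED: p06's letter quantifies over ALL realisations `ρ_w ≅ cmPrincipalSeriesH χ₂ χ₁`, reducible ones included; the reducible case needs the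
Jordan–Hölder series of `i_H(χ₂ ⊠ χ₁)` at a split place (★ `uTwoPrincipalSeriesJH_holds` is non-split only) — reshape ask «insert `ρw.IsIrreducible`» filed with the
dealer (R90 bus 2026-09-05T01:25Z); with it, (M-a)′ := §2 (+ ★ admissibility of the principal series) is PAID modulo (HC-LI) by name.
HONEST LABEL: conditional on S4's (HC-LI) socket (an XL analytic input, Harish-Chandra's theorem for the `p`-adic group `H_w`) — the gate records `hHCLI` as a hypothesis,
not a fact; pays no socket by itself; HC_CM is proved only modulo the 7 printed citations (2 remaining named inputs: hLiu418 = `stmt-HodgeConjecture-24832`,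
h413 = `stmt-HodgeConjecture-24833`) until rung 0 closes; REL ≠ ★ ≠ BUILT; count-neutral.

## References
* [Rogawski1990] J. D. Rogawski, *Automorphic Representations of Unitary Groups in Three Variables*, Ann. of Math. Stud. 123 (1990): §1.6 pp. 5–6; §3.1 p. 19;
  §4.3 (4.3.1) p. 43; §4.9 Lemma 4.9.2 pp. 55–56; §12.5 p. 182; §13.8 p. 217, p. 219 L3; §14.2 p. 232.
* [HarishChandra1970] Harish-Chandra (notes by G. van Dijk), *Harmonic analysis on reductive p-adic groups*, LNM 162 (1970), Lemma 42.
* [HarishChandra1999] Harish-Chandra (notes by S. DeBacker, P. J. Sally), *Admissible invariant distributions on reductive p-adic groups*, AMS ULS 16 (1999), Thm. 16.3.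
* [vanDijk1972] G. van Dijk, *Computation of certain induced characters of 𝔭-adic groups*, Math. Ann. 199 (1972), Thm. p. 237.
-/

set_option autoImplicit false
set_option linter.dupNamespace false

noncomputable section

open scoped Matrix MatrixGroups
open MeasureTheory NumberField IsDedekindDomain
open Literature.NumberTheory.Rogawski1990 Literature.NumberTheory.Automorphic Literature.NumberTheory.Automorphic.UnitaryGroup
open Literature.NumberTheory.GaloisRepresentations
open Summit.HodgeConjecture.HodgeConjecture.Cruxes.H413.K2E1TraceFormulaBeta

namespace Summit.HodgeConjecture.HodgeConjecture.R90.S10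

variable (L : Type) [Field L] [NumberField L] [IsCMField L] (w : Pl L)

/-! ## §1 At a split place, `Δ‴_w`-partners have equal `G`-regular CLASS orbital integrals -/

/-- **At a SPLIT place the stable orbital integral IS the class orbital integral**: `Φ^{st}(a, f) = Φ(⟦a⟧, f)` for every `a ∈ H_w` — the `finsum` over the stable
class runs over the singleton `{⟦a⟧}` (★ `R90.S4.setOf_isLocalStablyConjH_out_eq_singleton_of_split`). [cite: Rogawski1990, §3.1 p. 19; §4.1 (4.1.1) p. 39; §14.2 p. 232] -/
theorem stableOrbitalIntegralRel_eq_classOrbitalIntegral_of_split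
    [∀ a : HLoc L w, MeasurableSpace (HLoc L w ⧸ Subgroup.centralizer ({a} : Set (HLoc L w)))]
    (W : PlacesOver L w) (hW : IsCMField.complexConj L • W.1 ≠ W.1) (mH : OrbitalMeasureFamily (HLoc L w)) (f : HLoc L w → ℂ) (a : HLoc L w) :
    stableOrbitalIntegralRel (IsLocalStablyConjH L w) mH f a = classOrbitalIntegral mH f (ConjClasses.mk a) := by
  have hs := R90.S4.setOf_isLocalStablyConjH_out_eq_singleton_of_split L w W hW a
  rw [stableOrbitalIntegralRel_def, hs, finsum_mem_singleton]

/-- **Two `Δ_w`-transfers of the same `φ` have the same `G`-regular class orbital integrals at a SPLIT place**: the transfer identity (4.3.1) pins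
`Φ^{st}(γ_H, f^H) = Σ_γ Δ_w(γ_H, γ) Φ(γ, φ) = Φ^{st}(γ_H, f′^H)` at every `G`-regular `γ_H`, and `Φ^{st} = Φ(⟦·⟧)` by the previous lemma — for ANY local transfer factor `T`.
[cite: Rogawski1990, §4.3 (4.3.1) p. 43; §14.2 p. 232] -/
theorem classOrbitalIntegral_eq_of_isLocalDeltaTransfer_of_split
    [∀ a : HLoc L w, MeasurableSpace (HLoc L w ⧸ Subgroup.centralizer ({a} : Set (HLoc L w)))]
    [∀ γ : Gqs L w, MeasurableSpace (Gqs L w ⧸ Subgroup.centralizer ({γ} : Set (Gqs L w)))]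
    (W : PlacesOver L w) (hW : IsCMField.complexConj L • W.1 ≠ W.1) (T : LocalTransferFactor L (qsForm L) w)
    (mH : OrbitalMeasureFamily (HLoc L w)) (mQ : OrbitalMeasureFamily (Gqs L w)) {fH fH' : HLoc L w → ℂ} {φ : Gqs L w → ℂ}
    (h : IsLocalDeltaTransfer L (qsForm L) w T mH mQ fH φ) (h' : IsLocalDeltaTransfer L (qsForm L) w T mH mQ fH' φ)
    (γ : HLoc L w) (hγ : IsLocalGRegular L w γ) :
    classOrbitalIntegral mH fH (ConjClasses.mk γ) = classOrbitalIntegral mH fH' (ConjClasses.mk γ) := by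
  have h1 : stableOrbitalIntegralRel (IsLocalStablyConjH L w) mH fH γ = _ := h γ hγ
  have h2 : stableOrbitalIntegralRel (IsLocalStablyConjH L w) mH fH' γ = _ := h' γ hγ
  rw [stableOrbitalIntegralRel_eq_classOrbitalIntegral_of_split L w W hW] at h1 h2
  exact h1.trans h2.symm

/-! ## §2 The trace of an irreducible admissible `ρ_w` on matched pairs, modulo Harish-Chandra regularity (S4's socket (HC-LI)) -/

/-- **(M-a) AT A SPLIT PLACE FOR IRREDUCIBLE `ρ_w`, MODULO (HC-LI).**  Hypothesis `hHCLI` = the TYPE of S4's socket `stub_R90_S4_H_charLocIntHC` token for token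
(Harish-Chandra regularity on `H_v`, every place: each admissible irreducible class `σ` has a conjugation-invariant locally integrable measurable density `Θ_σ` with
`Tr σ(f) = ∫ f Θ_σ` on test functions).  Then at a place `w` SPLIT in `L` (`c • W ≠ W` for some `W ∣ w`), for a CANONICAL family `mHw` (★ `IsCanonical` for the
`G`-regular classes and the right-invariant Haar measure `νHw`), every irreducible admissible smooth `ρ_w` of `H_w` and every two C2-matched pairs `(f^H, φ)`, `(f′^H, φ)`
with the SAME `φ` (★ `MatchE1`: smooth + `Δ‴_w`-transfer at the factor of record): `Tr ρ_w(f^H) = Tr ρ_w(f′^H)` — `= ∫ f^H Θ = ∫ f′^H Θ` by ★ (ORB-DET) at `Θ = Θ_{⟦ρ_w⟧}`, the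
class orbital integrals agreeing by §1.  (Lemma 4.9.2's «any matched pair» at a split place; the consumer's `ρ_w = 𝔥.ρ w` is irreducible, ★ C2 `S10HDatum.hirr`.)
[cite: Rogawski1990, §4.9 Lemma 4.9.2 pp. 55–56; §12.5 p. 182; §1.6 pp. 5–6; §13.8 p. 217] [cite: HarishChandra1970, Lemma 42] [cite: HarishChandra1999, Thm. 16.3] -/
theorem smoothTrace_eq_of_matchE1_of_split_of_irreducible
    (hHCLI : ∀ (L : Type) [Field L] [NumberField L] [IsCMField L] (v : HeightOneSpectrum (𝓞 ↥(maximalRealSubfield L)))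
      [MeasurableSpace (HLoc L v)] [BorelSpace (HLoc L v)]
      (νH : MeasureTheory.Measure (HLoc L v)) [νH.IsHaarMeasure] [νH.IsMulRightInvariant],
      ∀ σ : IrrClass (HLoc L v), σ.IsAdmissible →
        ∃ Θ : HLoc L v → ℂ,
          MeasureTheory.LocallyIntegrable Θ νH ∧ Measurable Θ ∧
          (∀ x g : HLoc L v, Θ (x * g * x⁻¹) = Θ g) ∧
          ∀ f : HLoc L v → ℂ, Literature.NumberTheory.Rogawski1990.IsLocSmooth f →
            σ.smoothTrace νH f = MeasureTheory.integral νH (fun g => f g * Θ g))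
    (W : PlacesOver L w) (hW : IsCMField.complexConj L • W.1 ≠ W.1)
    [MeasurableSpace (HLoc L w)] [BorelSpace (HLoc L w)]
    [∀ a : HLoc L w, MeasurableSpace (HLoc L w ⧸ Subgroup.centralizer ({a} : Set (HLoc L w)))]
    [∀ a : HLoc L w, BorelSpace (HLoc L w ⧸ Subgroup.centralizer ({a} : Set (HLoc L w)))]
    [∀ γ : Gqs L w, MeasurableSpace (Gqs L w ⧸ Subgroup.centralizer ({γ} : Set (Gqs L w)))]
    (νHw : Measure (HLoc L w)) [νHw.IsHaarMeasure] [νHw.IsMulRightInvariant]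
    (mHw : OrbitalMeasureFamily (HLoc L w)) (mQw : OrbitalMeasureFamily (Gqs L w)) (hm : mHw.IsCanonical (IsLocalGRegular L w) νHw)
    (μ : HeckeCharacter L) {Vw : Type} [AddCommGroup Vw] [Module ℂ Vw] (ρw : Representation ℂ (HLoc L w) Vw)
    (hirr : ρw.IsIrreducible) (hsm : ρw.IsSmooth) (hadm : ρw.IsAdmissible)
    {fH fH' : HLoc L w → ℂ} {φ : Gqs L w → ℂ} (h : MatchE1 L μ w mHw mQw fH φ) (h' : MatchE1 L μ w mHw mQw fH' φ) :
    ρw.smoothTrace νHw fH = ρw.smoothTrace νHw fH' := by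
  -- the class `σ = ⟦ρ_w⟧` and its Harish-Chandra density
  let r : SmoothIrrep (HLoc L w) := { V := Vw, ρ := ρw, isIrreducible := hirr, isSmooth := hsm }
  have hσ : (IrrClass.mk r).IsAdmissible := (IrrClass.isAdmissible_mk r).2 hadm
  obtain ⟨Θ, hΘi, hΘm, hΘinv, hΘtr⟩ := hHCLI L w νHw (IrrClass.mk r) hσ
  -- the matched pairs: smoothness and equal `G`-regular class orbital integrals (§1)
  have hfH : IsLocSmooth fH := h.1
  have hfH' : IsLocSmooth fH' := h'.1
  have hO : ∀ γ, IsLocalGRegular L w γ → classOrbitalIntegral mHw fH (ConjClasses.mk γ) = classOrbitalIntegral mHw fH' (ConjClasses.mk γ) :=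
    fun γ hγ => classOrbitalIntegral_eq_of_isLocalDeltaTransfer_of_split L w W hW _ mHw mQw h.2.2 h'.2.2 γ hγ
  -- ★ (ORB-DET) at the density `Θ`
  have key := R90.S4.integral_mul_eq_of_classOrbitalIntegral_eq_of_isLocSmooth L w νHw mHw hm Θ hΘi hΘm hΘinv fH fH' hfH hfH' hO
  change (IrrClass.mk r).smoothTrace νHw fH = (IrrClass.mk r).smoothTrace νHw fH'
  rw [hΘtr fH hfH, hΘtr fH' hfH']
  exact key

/-! ## §3 (M-a)′ — p06's letter body with `ρw.IsIrreducible` inserted, modulo (HC-LI) -/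

/-- **(M-a)′ = `SplitHVanDijkLetter`'s BODY FOR IRREDUCIBLE REALISATIONS, MODULO (HC-LI).**  Under `hHCLI` (the TYPE of S4's socket `stub_R90_S4_H_charLocIntHC`):
at a place `w` split in `L`, for `mHw` canonical, every inducing pair `(χ₂, χ₁)` (`χ₁` smooth), every IRREDUCIBLE realisation `ρ_w ≅ i_H(χ₂ ⊠ χ₁)`
(★ `cmPrincipalSeriesH`; admissible and smooth by ★ `isAdmissible_cmPrincipalSeriesH` transported along the equivalence), and every two C2-matched pairs
`(f^H, φ)`, `(f′^H, φ)`: `Tr ρ_w(f^H) = Tr ρ_w(f′^H)` (§2).  The binders are those of p06's `SplitHVanDijkLetter L μ w νHw mHw mQw` (★-cand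
`R90S10PSSplitInputLettersDefs` :70–:84) with `ρw.IsIrreducible →` inserted after the equivalence — the reshaped letter is paid by this term.
[cite: Rogawski1990, §4.9 Lemma 4.9.2 pp. 55–56; §12.1 p. 171; §13.8 p. 217] [cite: vanDijk1972, Thm. p. 237] [cite: HarishChandra1999, Thm. 16.3] -/
theorem splitHVanDijk_of_irreducible
    (hHCLI : ∀ (L : Type) [Field L] [NumberField L] [IsCMField L] (v : HeightOneSpectrum (𝓞 ↥(maximalRealSubfield L)))
      [MeasurableSpace (HLoc L v)] [BorelSpace (HLoc L v)]
      (νH : MeasureTheory.Measure (HLoc L v)) [νH.IsHaarMeasure] [νH.IsMulRightInvariant],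
      ∀ σ : IrrClass (HLoc L v), σ.IsAdmissible →
        ∃ Θ : HLoc L v → ℂ,
          MeasureTheory.LocallyIntegrable Θ νH ∧ Measurable Θ ∧
          (∀ x g : HLoc L v, Θ (x * g * x⁻¹) = Θ g) ∧
          ∀ f : HLoc L v → ℂ, Literature.NumberTheory.Rogawski1990.IsLocSmooth f →
            σ.smoothTrace νH f = MeasureTheory.integral νH (fun g => f g * Θ g))
    (μ : HeckeCharacter L)
    {_msH : MeasurableSpace (HLoc L w)} [BorelSpace (HLoc L w)]
    {_qH : ∀ a : HLoc L w, MeasurableSpace (HLoc L w ⧸ Subgroup.centralizer ({a} : Set (HLoc L w)))}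
    [∀ a : HLoc L w, BorelSpace (HLoc L w ⧸ Subgroup.centralizer ({a} : Set (HLoc L w)))]
    {_qQ : ∀ γ : Gqs L w, MeasurableSpace (Gqs L w ⧸ Subgroup.centralizer ({γ} : Set (Gqs L w)))}
    (νHw : Measure (HLoc L w)) [νHw.IsHaarMeasure] [νHw.IsMulRightInvariant]
    (mHw : OrbitalMeasureFamily (HLoc L w)) (mQw : OrbitalMeasureFamily (Gqs L w)) :
    (∃ W : PlacesOver L w, IsCMField.complexConj L • W.1 ≠ W.1) →
      mHw.IsCanonical (IsLocalGRegular L w) νHw →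
      ∀ (χ₂ : ↥(torusU (conjLocal L (IsCMField.complexConj L) w) (cmLocalForm L 2 w)) →* ℂˣ) (χ₁ : H1Loc L w →* ℂˣ),
        IsOpen ((χ₁.ker : Subgroup (H1Loc L w)) : Set (H1Loc L w)) →
        ∀ ⦃Vw : Type⦄ [AddCommGroup Vw] [Module ℂ Vw] (ρw : Representation ℂ (HLoc L w) Vw),
          Nonempty (ρw.Equiv (cmPrincipalSeriesH L w χ₂ χ₁)) → ρw.IsIrreducible →
          ∀ (fH fH' : HLoc L w → ℂ) (φ : Gqs L w → ℂ), MatchE1 L μ w mHw mQw fH φ → MatchE1 L μ w mHw mQw fH' φ →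
            ρw.smoothTrace νHw fH = ρw.smoothTrace νHw fH' := by
  rintro ⟨W, hW⟩ hm χ₂ χ₁ hχ₁ Vw _ _ ρw ⟨e⟩ hirr fH fH' φ h h'
  haveI := locallyCompactSpace_cmBorelU L 2 w
  have hadm : ρw.IsAdmissible := (isAdmissible_cmPrincipalSeriesH L w χ₂ χ₁ hχ₁).of_equiv e.symm
  exact smoothTrace_eq_of_matchE1_of_split_of_irreducible L w hHCLI W hW νHw mHw mQw hm μ ρw hirr hadm.isSmooth hadm h h'

end Summit.HodgeConjecture.HodgeConjecture.R90.S10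

end
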